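import Summits.CriticalPhenomena.PercolationContinuityZ3.Theorems.PercNearOneGluingNoHeavyLowerTailSahiCTCLadderRowTwoTSupplyML
import Summits.CriticalPhenomena.PercolationContinuityZ3.Theorems.PercNearOneGluingNoHeavyLowerTailSahiCTCLadderRowTwoTArith
import HarnessLib

/-!
# `NoHeavyLowerTail` (crux stmt-CriticalPhenomena-4575), P3 lane: the row `#dbl = 2` of `(L_t)` for every `t` (conditional on four signs)

Support file (seat `prim-l12-p3`, gen 26; `--supports stmt-CriticalPhenomena-4575`).  Memo g26 §4.16.  Assembles the supply facts
(`rowTwoT_supply_R/_M/_L`), the cube and charge identities (`cubes_le_coeff_ee_mul_harris_rowTwoT`, `coeff_chargeT_rowTwoT_le`) and the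
certificate `rowTwoT_arith`: **`coeff_ladder_rowTwoT_nonneg_of_signs`** — for `t`-live up-sets, every `t ≥ 2`, every profile `m` with two
doubled points, exponents ≤ 2 and `#(lev m 1) + 2 = n + t` with `n ≥ 2t − 2`, `[m] L_t ≥ 0` PROVIDED the four elimination multipliers
(explicit polynomials in `n`, `t` and the five numbers `cH(t,n+1), cH(t−1,n+1), cH(t−1,n−1), cH(t−2,n−1), cH(t−2,n−2)`) are nonnegative —
which holds for all `n ≥ 2t − 2` when `t ≥ 4` and for `n ≥ 6` when `t = 3` (exact check for `t ≤ 8`, `n ≤ 6t`, code/gen26/row2t.py);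
the general-`t` proof of the signs is the one remaining step.  Nothing is asserted about the crux.
-/

namespace Summit.CriticalPhenomena.PercolationContinuityZ3.Theorems.SahiCTCForms

open Finset MvPolynomial SahiCTCGenFun SahiCTCWeightedLYM

variable {α : Type*} [DecidableEq α] [Fintype α]

/-- **ROW `#dbl = 2` OF `(L_t)`, EVERY `t ≥ 2`, GIVEN THE SIGNS** of the four elimination multipliers of `rowTwoT_arith`. [this work] -/
theorem coeff_ladder_rowTwoT_nonneg_of_signs {𝒳 𝒵 : Finset (Finset α)} (h𝒳 : IsUpperSet (𝒳 : Set (Finset α)))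
    (h𝒵 : IsUpperSet (𝒵 : Set (Finset α))) {t : ℕ} (ht : 2 ≤ t) (hXt : ∀ S ∈ 𝒳, t ≤ #S) (hZt : ∀ S ∈ 𝒵, t ≤ #S)
    {m : α →₀ ℕ} (hm : ∀ i, m i ≤ 2) (hD : #(dbl m) = 2) {n : ℕ} (hn : #(lev m 1) + 2 = n + t) (hnt : 2 * t ≤ n + 2)
    (hu : 0 ≤ ((cH (t - 2) (n - 2) : ℤ) * (2 * ((n : ℤ) + 1) * (n : ℤ) * ((n : ℤ) - 1)) - (2 * (cH (t - 1) (n + 1) : ℤ) * (t : ℤ) * ((t : ℤ) - 1) * ((n : ℤ) - (t : ℤ) + 1)))) (hv : 0 ≤ ((((cH t (n + 1) : ℤ) + (cH (t - 1) (n + 1) : ℤ)) * (t : ℤ) * ((t : ℤ) - 1) * ((n : ℤ) - (t : ℤ) + 2) * ((n : ℤ) - (t : ℤ) + 1)) - (((n : ℤ) + 2) * ((n : ℤ) + 1) * (n : ℤ) * ((n : ℤ) - 1)) * (cH (t - 2) (n - 2) : ℤ))) (hdet : 0 < ((((cH t (n + 1) : ℤ) + (cH (t - 1) (n + 1) : ℤ))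 * (t : ℤ) * ((t : ℤ) - 1) * ((n : ℤ) - (t : ℤ) + 2) * ((n : ℤ) - (t : ℤ) + 1)) * (2 * ((n : ℤ) + 1) * (n : ℤ) * ((n : ℤ) - 1)) - (((n : ℤ) + 2) * ((n : ℤ) + 1) * (n : ℤ) * ((n : ℤ) - 1)) * (2 * (cH (t - 1) (n + 1) : ℤ) * (t : ℤ) * ((t : ℤ) - 1) * ((n : ℤ) - (t : ℤ) + 1)))) (hd2 : 0 < (((t : ℤ) - 1) * (((cH (t - 1) (n - 1) : ℤ) + (cH (t - 2) (n - 1) : ℤ)) * ((n : ℤ) - (t : ℤ) + 1) - (n : ℤ) * (cH (t - 2) (n - 1) : ℤ))))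
    (h1P : 0 ≤ ((((cH t (n + 1) : ℤ) + (cH (t - 1) (n + 1) : ℤ)) * (t : ℤ) * ((t : ℤ) - 1) * ((n : ℤ) - (t : ℤ) + 2) * ((n : ℤ) - (t : ℤ) + 1)) * (2 * ((n : ℤ) + 1) * (n : ℤ) * ((n : ℤ) - 1)) - (((n : ℤ) + 2) * ((n : ℤ) + 1) * (n : ℤ) * ((n : ℤ) - 1)) * (2 * (cH (t - 1) (n + 1) : ℤ) * (t : ℤ) * ((t : ℤ) - 1) * ((n : ℤ) - (t : ℤ) + 1))) * (cH (t - 1) (n - 1) : ℤ) - ((cH (t - 2) (n - 2) : ℤ) * (2 * ((n : ℤ) + 1) * (n : ℤ) * ((n : ℤ) - 1)) - (2 * (cH (t - 1) (n + 1) : ℤ) * (t : ℤ) * ((t : ℤ) - 1) * ((n : ℤ) - (t : ℤ) + 1))) * (((cH t (n + 1) : ℤ) + (cH (t - 1) (n + 1) : ℤ)) * (t : ℤ) * ((t : ℤ) - 1) * ((n : ℤ) - 1) * ((n : ℤ) - (t : ℤ) + 2)) - ((((cH t (n + 1) : ℤ) + (cH (t - 1) (n + 1) : ℤ)) * (t :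 ℤ) * ((t : ℤ) - 1) * ((n : ℤ) - (t : ℤ) + 2) * ((n : ℤ) - (t : ℤ) + 1)) - (((n : ℤ) + 2) * ((n : ℤ) + 1) * (n : ℤ) * ((n : ℤ) - 1)) * (cH (t - 2) (n - 2) : ℤ)) * ((cH t (n + 1) : ℤ) * ((t : ℤ) - 1) * ((n : ℤ) - 1) * ((n : ℤ) - (t : ℤ) + 2) + (cH (t - 1) (n + 1) : ℤ) * (t : ℤ) * ((t : ℤ) - 1) * ((n : ℤ) - 1)))
    (h1Q : 0 ≤ (n : ℤ) * (((cH (t - 2) (n - 2) : ℤ) * (2 * ((n : ℤ) + 1) * (n : ℤ) * ((n : ℤ) - 1)) - (2 * (cH (t - 1) (n + 1) : ℤ) * (t : ℤ) * ((t : ℤ) - 1) * ((n : ℤ) - (t : ℤ) + 1))) * (((cH t (n + 1) : ℤ) + (cH (t - 1) (n + 1) : ℤ)) * (t : ℤ) * ((t : ℤ) - 1) * ((n : ℤ) - 1) * ((n : ℤ) - (t : ℤ) + 2)) + ((((cH t (n + 1) : ℤ) + (cH (t - 1) (n + 1) : ℤ)) * (t : ℤ) * ((t : ℤ) - 1) *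 ((n : ℤ) - (t : ℤ) + 2) * ((n : ℤ) - (t : ℤ) + 1)) - (((n : ℤ) + 2) * ((n : ℤ) + 1) * (n : ℤ) * ((n : ℤ) - 1)) * (cH (t - 2) (n - 2) : ℤ)) * ((cH t (n + 1) : ℤ) * ((t : ℤ) - 1) * ((n : ℤ) - 1) * ((n : ℤ) - (t : ℤ) + 2) + (cH (t - 1) (n + 1) : ℤ) * (t : ℤ) * ((t : ℤ) - 1) * ((n : ℤ) - 1))) - ((t : ℤ) - 1) * ((((cH t (n + 1) : ℤ) + (cH (t - 1) (n + 1) : ℤ)) * (t : ℤ) * ((t : ℤ) - 1) * ((n : ℤ) - (t : ℤ) + 2) * ((n : ℤ) - (t : ℤ) + 1)) * (2 * ((n : ℤ) + 1) * (n : ℤ) * ((n : ℤ) - 1)) - (((n : ℤ) + 2) * ((n : ℤ) + 1) * (n : ℤ) * ((n : ℤ) - 1)) * (2 * (cH (t - 1) (n + 1) : ℤ) * (t : ℤ) * ((t : ℤ) - 1) * ((n : ℤ) - (t : ℤ) + 1))) * ((cH (t - 1) (n - 1) : ℤ) + (cH (t - 2) (n - 1) : ℤ))) :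
    0 ≤ (ee t * (PiP * gf (𝒳 ∩ 𝒵) - gf 𝒳 * gf 𝒵) -
      gf (bySize (· ≤ t - 1) : Finset (Finset α)) * gf (bySize (t ≤ ·) : Finset (Finset α)) *
        gf ((𝒳 ∩ 𝒵).filter fun S => #S = t)).coeff m := by
  set W := (𝒳 ∩ 𝒵).filter fun S => #S = t with hWdef
  have hWt : ∀ w ∈ W, #w = t := fun w hw => (mem_filter.1 hw).2
  have hWsub : ∀ w ∈ W, w ∈ 𝒳 ∧ w ∈ 𝒵 := fun w hw => mem_inter.1 (mem_filter.1 hw).1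
  have hDT : Disjoint (dbl m) (lev m 1) := disjoint_dbl_lev_one m
  obtain ⟨d₁, d₂, h12, hDeq⟩ := card_eq_two.1 hD
  have hDeq' : dbl m = {d₂, d₁} := by rw [hDeq, pair_comm]
  rw [coeff_sub, sub_nonneg]
  refine (coeff_chargeT_rowTwoT_le ht hm hD (by omega) W hWt).trans
    (le_trans ?_ (cubes_le_coeff_ee_mul_harris_rowTwoT h𝒳 h𝒵 ht hm hD))
  have hn₁ : d₁ ∉ ({d₂} : Finset α) := by simp [h12]
  have hsumD : ∀ f : α → ℤ, ∑ d ∈ dbl m, f d = f d₁ + f d₂ := fun f => by rw [hDeq, sum_insert hn₁, sum_singleton]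
  have hsumDn : ∀ f : α → ℕ, ∑ d ∈ dbl m, f d = f d₁ + f d₂ := fun f => by rw [hDeq, sum_insert hn₁, sum_singleton]
  -- the charged counts are at most a, q₁, q₂, ε
  have haW : #(((lev m 1).powersetCard (t - 2)).filter fun Y => dbl m ∪ Y ∈ W) ≤
      #(((lev m 1).powersetCard (t - 2)).filter fun Y => dbl m ∪ Y ∈ 𝒳 ∧ dbl m ∪ Y ∈ 𝒵) :=
    card_le_card fun Y hY => mem_filter.2 ⟨(mem_filter.1 hY).1, hWsub _ (mem_filter.1 hY).2⟩
  have hqW : ∀ d, #(((lev m 1).powersetCard (t - 1)).filter fun Q => insert d Q ∈ W) ≤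
      #(((lev m 1).powersetCard (t - 1)).filter fun Q => insert d Q ∈ 𝒳 ∧ insert d Q ∈ 𝒵) := fun d =>
    card_le_card fun Q hQ => mem_filter.2 ⟨(mem_filter.1 hQ).1, hWsub _ (mem_filter.1 hQ).2⟩
  have hεW : #(((lev m 1).powersetCard t).filter fun E => E ∈ W) ≤ #(((lev m 1).powersetCard t).filter fun E => E ∈ 𝒳 ∧ E ∈ 𝒵) :=
    card_le_card fun E hE => mem_filter.2 ⟨(mem_filter.1 hE).1, hWsub _ (mem_filter.1 hE).2⟩
  -- the supply facts
  obtain ⟨N2P, N2Qa⟩ := rowTwoT_supply_R h𝒳 h𝒵 ht hXt hZt hDeq h12 hn hnt (𝒳 := 𝒳) (𝒵 := 𝒵)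
  obtain ⟨-, N2Qb⟩ := rowTwoT_supply_R h𝒳 h𝒵 ht hXt hZt hDeq' h12.symm hn hnt (𝒳 := 𝒳) (𝒵 := 𝒵)
  obtain ⟨N1Pa, N1Qa⟩ := rowTwoT_supply_M h𝒳 h𝒵 ht hXt hZt hDeq h12 hn hnt (𝒳 := 𝒳) (𝒵 := 𝒵)
  obtain ⟨N1Pb, N1Qb⟩ := rowTwoT_supply_M h𝒳 h𝒵 ht hXt hZt hDeq' h12.symm hn hnt (𝒳 := 𝒳) (𝒵 := 𝒵)
  have N0 := rowTwoT_supply_L h𝒳 h𝒵 ht hXt hZt hD hn (by omega) (𝒳 := 𝒳) (𝒵 := 𝒵)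
  -- Pascal
  have hPa : (cH t (n + 2) : ℤ) = cH t (n + 1) + cH (t - 1) (n + 1) := by exact_mod_cast cH_pascal t (n + 1) (by omega) (by omega)
  have hPb : (cH (t - 1) n : ℤ) = cH (t - 1) (n - 1) + cH (t - 2) (n - 1) := by
    obtain ⟨n', hn'⟩ : ∃ n', n = n' + 1 := ⟨n - 1, by omega⟩
    have h := cH_pascal (t - 1) n' (by omega) (by omega)
    rw [show t - 1 - 1 = t - 2 from by omega, ← hn'] at h
    rw [show n - 1 = n' from by omega]; exact_mod_cast h
  rw [hPa] at N2P
  rw [hPb] at N1Pa N1Pb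
  -- the charge's numeric arguments
  have e2 : #(lev m 1) - t + 4 = n + 2 := by omega
  have e1 : #(lev m 1) - t + 2 = n := by omega
  have e0 : #(lev m 1) - t = n - 2 := by omega
  rw [e2, e1, e0, hsumD fun d => ∑ Q ∈ (lev m 1).powersetCard (t - 1), kapL1 𝒳 𝒵 m d Q,
    hsumDn fun d => #(((lev m 1).powersetCard (t - 1)).filter fun Q => insert d Q ∈ W)]
  push_cast
  rw [hPa]
  have hPb' : (cH (t - 1) n : ℤ) = cH (t - 1) (n - 1) + cH (t - 2) (n - 1) := hPb
  rw [hPb']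
  have haW' : (#(((lev m 1).powersetCard (t - 2)).filter fun Y => dbl m ∪ Y ∈ W) : ℤ) ≤
      #(((lev m 1).powersetCard (t - 2)).filter fun Y => dbl m ∪ Y ∈ 𝒳 ∧ dbl m ∪ Y ∈ 𝒵) := by exact_mod_cast haW
  have hqW' : ((#(((lev m 1).powersetCard (t - 1)).filter fun Q => insert d₁ Q ∈ W) : ℤ)
        + #(((lev m 1).powersetCard (t - 1)).filter fun Q => insert d₂ Q ∈ W))
      ≤ (#(((lev m 1).powersetCard (t - 1)).filter fun Q => insert d₁ Q ∈ 𝒳 ∧ insert d₁ Q ∈ 𝒵) : ℤ)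
        + #(((lev m 1).powersetCard (t - 1)).filter fun Q => insert d₂ Q ∈ 𝒳 ∧ insert d₂ Q ∈ 𝒵) := by
    have := add_le_add (hqW d₁) (hqW d₂); exact_mod_cast this
  have hεW' : (#(((lev m 1).powersetCard t).filter fun E => E ∈ W) : ℤ) ≤ #(((lev m 1).powersetCard t).filter fun E => E ∈ 𝒳 ∧ E ∈ 𝒵) := by
    exact_mod_cast hεW
  -- combine the orientations into the forms of `rowTwoT_arith`
  generalize hSR : ∑ Y ∈ (lev m 1).powersetCard (t - 2), kap 𝒳 𝒵 ∅ (dbl m ∪ (lev m 1 \ Y)) = SR at N2P N2Qa N2Qb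
  generalize hM1 : ∑ Q ∈ (lev m 1).powersetCard (t - 1), kapL1 𝒳 𝒵 m d₁ Q = M1 at N1Pa N1Qa
  generalize hM2 : ∑ Q ∈ (lev m 1).powersetCard (t - 1), kapL1 𝒳 𝒵 m d₂ Q = M2 at N1Pb N1Qb
  generalize hSL : ∑ E ∈ (lev m 1).powersetCard t, kap 𝒳 𝒵 (dbl m) (lev m 1 \ E) = SL at N0
  generalize ha : (#(((lev m 1).powersetCard (t - 2)).filter fun Y => dbl m ∪ Y ∈ 𝒳 ∧ dbl m ∪ Y ∈ 𝒵) : ℤ) = a at N2P N2Qa N2Qb N1Pa N1Pb N1Qa N1Qb N0 haW'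
  generalize hq1 : (#(((lev m 1).powersetCard (t - 1)).filter fun Q => insert d₁ Q ∈ 𝒳 ∧ insert d₁ Q ∈ 𝒵) : ℤ) = q₁ at N2P N2Qa N2Qb N1Pb N1Qb hqW'
  generalize hq2 : (#(((lev m 1).powersetCard (t - 1)).filter fun Q => insert d₂ Q ∈ 𝒳 ∧ insert d₂ Q ∈ 𝒵) : ℤ) = q₂ at N2P N2Qa N2Qb N1Pa N1Qa hqW'
  generalize hε : (#(((lev m 1).powersetCard t).filter fun E => E ∈ 𝒳 ∧ E ∈ 𝒵) : ℤ) = ε at N2P N2Qa N2Qb hεW'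
  generalize ha' : (#(((lev m 1).powersetCard (t - 2)).filter fun Y => dbl m ∪ Y ∈ W) : ℤ) = a' at haW' ⊢
  generalize hq1' : (#(((lev m 1).powersetCard (t - 1)).filter fun Q => insert d₁ Q ∈ W) : ℤ) = q₁' at hqW' ⊢
  generalize hq2' : (#(((lev m 1).powersetCard (t - 1)).filter fun Q => insert d₂ Q ∈ W) : ℤ) = q₂' at hqW' ⊢
  generalize hε' : (#(((lev m 1).powersetCard t).filter fun E => E ∈ W) : ℤ) = ε' at hεW' ⊢
  have N2Q : (cH t (n + 1) : ℤ) * (((t : ℤ)) - 1) * (2 * (n : ℤ) * ((n : ℤ) - 1) * a + ((n : ℤ) - 1) * ((n : ℤ) - (t : ℤ) + 2) * (q₁ + q₂))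
      + (cH (t - 1) (n + 1) : ℤ) * (t : ℤ) * ((t : ℤ) - 1) * (((n : ℤ) - 1) * (q₁ + q₂) + 2 * ((n : ℤ) - (t : ℤ) + 1) * ε) ≤ 2 * ((n : ℤ) + 1) * (n : ℤ) * ((n : ℤ) - 1) * SR := by
    linarith only [N2Qa, N2Qb]
  have N2P' : ((cH t (n + 1) : ℤ) + (cH (t - 1) (n + 1) : ℤ)) * (t : ℤ) * ((t : ℤ) - 1) * ((n : ℤ) * ((n : ℤ) - 1) * a + ((n : ℤ) - 1) * ((n : ℤ) - (t : ℤ) + 2) * (q₁ + q₂) + ((n : ℤ) - (t : ℤ) + 2) * ((n : ℤ) - (t : ℤ) + 1) * ε)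
      ≤ ((n : ℤ) + 2) * ((n : ℤ) + 1) * (n : ℤ) * ((n : ℤ) - 1) * SR := by linarith only [N2P]
  have N1P : ((cH (t - 1) (n - 1) : ℤ) + (cH (t - 2) (n - 1) : ℤ)) * (2 * (n : ℤ) * a + ((n : ℤ) - (t : ℤ) + 1) * (q₁ + q₂)) ≤ (n : ℤ) * (M1 + M2) := by linarith only [N1Pa, N1Pb]
  have N1Q : 2 * (n : ℤ) * (cH (t - 1) (n - 1) : ℤ) * a + ((t : ℤ) - 1) * (cH (t - 2) (n - 1) : ℤ) * (q₁ + q₂) ≤ ((t : ℤ) - 1) * (M1 + M2) := by linarith only [N1Qa, N1Qb]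
  have N0' : (cH (t - 2) (n - 2) : ℤ) * (n : ℤ) * ((n : ℤ) - 1) * a ≤ (t : ℤ) * ((t : ℤ) - 1) * SL := by linarith only [N0]
  have hfin := rowTwoT_arith (SM := M1 + M2) (a' := a') (q' := q₁' + q₂') (e' := ε') (by exact_mod_cast ht) N2P' N2Q N1P N1Q N0'
    hu hv hdet hd2 h1P h1Q (by positivity) (by positivity) (Nat.cast_nonneg _) haW' hqW' hεW'
  linarith only [hfin]

end Summit.CriticalPhenomena.PercolationContinuityZ3.Theorems.SahiCTCForms
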